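import Summits.QuantumFields.GaugeBoot.Certificates.N1c1D3b2Lo
import Summits.QuantumFields.GaugeBoot.Certificates.N1c1D3b2Rows
import Summits.QuantumFields.GaugeBoot.Certificates.N1c1D3Tab0
import Summits.QuantumFields.GaugeBoot.Certificates.N1c1D3Tab1
import Summits.QuantumFields.GaugeBoot.Certificates.N1c1D3Tab2
import HarnessLib

/-!
# `N1c1D3b2Lo` restated over the SHARED family tables (uniform interface for the β_std = 2 lower end)

HONEST FRAMING (cell `pub-gaugeboot`): certified bounds on lattice expectations at stated coupling,
gauge group, dimension and torus size; NOT a mass gap, NOT a continuum limit, NOT a string tension;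
NOT Yang–Mills-summit-bearing (barriers `FixedCouplingUltralocality`, `PerturbativeInvisibility`).

`Certificates/N1c1D3b2Lo.lean` (the first sparse replay, emitter 0.7) carries its OWN copies of the class tables and
rows; every later certificate of the N1 `glyz-c1` family (emitter 0.7.1) states its hypotheses over the shared
`Certificates.N1c1D3.gramBlock<k>` (`N1c1D3Tab0/1/2`) and `Certificates.N1c1D3b<β>.rowEQ/rhsQ` (module `Certificates/N1c1D3b<β>Rows.lean`). This file checks
by `decide +kernel` that the inline data of `N1c1D3b2Lo` ARE the shared data (`cls<k>` tables and the 103 rows at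
β_std = 2) and restates the certified lower bound in the uniform shape,
`var_ge_of_feasible_shared … (heq : ∀ e, Σ_v N1c1D3b2.rowEQ e v · y v = rhsQ e) (hpsd_k : (N1c1D3.gramBlock<k> y).PosSemidef) :
lowerQ ≤ y 1`, so that a lattice binding treats all 24 certificates alike. No new data, no lattice claim.
-/

namespace Summit.QuantumFields.GaugeBoot.Certificates.N1c1D3b2Lo

noncomputable section

open Matrix Summit.QuantumFields.GaugeBoot.Certificates.Sparse

set_option maxHeartbeats 0 in
/-- Kernel check: the inline H class table of `N1c1D3b2Lo` is the shared one. -/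
theorem cls0_eq_shared : ∀ i j : Fin 85, cls0 i j = N1c1D3.cls0 i j := by
  decide +kernel

set_option maxHeartbeats 0 in
/-- Kernel check: the inline site-reflection class table of `N1c1D3b2Lo` is the shared one. -/
theorem cls1_eq_shared : ∀ i j : Fin 46, cls1 i j = N1c1D3.cls1 i j := by
  decide +kernel

set_option maxHeartbeats 0 in
/-- Kernel check: the inline link-reflection class table of `N1c1D3b2Lo` is the shared one. -/
theorem cls2_eq_shared : ∀ i j : Fin 46, cls2 i j = N1c1D3.cls2 i j := by
  decide +kernel

set_option maxHeartbeats 0 in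
/-- Kernel check: the inline equality rows of `N1c1D3b2Lo` are the shared β_std = 2 rows. -/
theorem rowEQ_eq_shared : ∀ e : Fin 103, ∀ v : Fin 435, rowEQ e v = N1c1D3b2.rowEQ e v := by
  decide +kernel

set_option maxHeartbeats 0 in
/-- Kernel check: the inline right-hand sides of `N1c1D3b2Lo` are the shared ones. -/
theorem rhsQ_eq_shared : ∀ e : Fin 103, rhsQ e = N1c1D3b2.rhsQ e := by
  decide +kernel

/-- The inline block linear forms are the shared ones. -/
theorem gramBlock0_eq_shared (y : Fin 435 → ℝ) : gramBlock0 y = N1c1D3.gramBlock0 y := by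
  ext i j
  rw [gramBlock0_apply, N1c1D3.gramBlock0_apply, cls0_eq_shared]

/-- The inline block linear forms are the shared ones. -/
theorem gramBlock1_eq_shared (y : Fin 435 → ℝ) : gramBlock1 y = N1c1D3.gramBlock1 y := by
  ext i j
  rw [gramBlock1_apply, N1c1D3.gramBlock1_apply, cls1_eq_shared]

/-- The inline block linear forms are the shared ones. -/
theorem gramBlock2_eq_shared (y : Fin 435 → ℝ) : gramBlock2 y = N1c1D3.gramBlock2 y := by
  ext i j
  rw [gramBlock2_apply, N1c1D3.gramBlock2_apply, cls2_eq_shared]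

/-- **The certified LOWER bound on `y_1` at β_std = 2, uniform interface**: hypotheses over the shared rows
`N1c1D3b2.rowEQ/rhsQ` and the shared blocks `N1c1D3.gramBlock<k>`; conclusion
`119041087716719753588763/302231454903657293676544 (= lowerQ) ≤ y 1`. -/
theorem var_ge_of_feasible_shared {y : Fin 435 → ℝ} (hy0 : y 0 = 1)
    (hρ : ∀ v : Fin 435, v ≠ 0 → |y v| ≤ 1)
    (heq : ∀ e : Fin 103, ∑ v, (N1c1D3b2.rowEQ e v : ℝ) * y v = N1c1D3b2.rhsQ e)
    (hpsd0 : (N1c1D3.gramBlock0 y).PosSemidef) (hpsd1 : (N1c1D3.gramBlock1 y).PosSemidef)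
    (hpsd2 : (N1c1D3.gramBlock2 y).PosSemidef) :
    (lowerQ : ℝ) ≤ y 1 := by
  refine var_ge_of_feasible hy0 hρ (fun e => ?_) ?_ ?_ ?_
  · rw [rhsQ_eq_shared, ← heq e]
    exact Finset.sum_congr rfl fun v _ => by rw [rowEQ_eq_shared]
  · rw [gramBlock0_eq_shared]; exact hpsd0
  · rw [gramBlock1_eq_shared]; exact hpsd1
  · rw [gramBlock2_eq_shared]; exact hpsd2

end

end Summit.QuantumFields.GaugeBoot.Certificates.N1c1D3b2Lo
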